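/-
Copyright (c) 2026. All rights reserved.
Released under Apache 2.0 license as described in the file LICENSE.
Authors: abc-iut cell, statement-typer seat abc-iut-L4-t4 (wave 1; gen 6; doc v2 gen 11).
-/
import Literature.AnabelianGeometry.AbsoluteAnabelian.AbsTopIII.Thm19CuspidalDegreeZHat
import HarnessLib

/-!
# [AbsTopIII] Prop. 1.6 (iii) / Thm. 1.9 (c): the cuspidal degree MAP `H¹(Π_U, M_Z) → ⊕_{z} Ẑ`
# through THE synchronizations — definition, additivity, kernel

Mochizuki, *Topics in Absolute Anabelian Geometry III*, §1, Prop. 1.6 (iii), manuscript p. 35, render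
lines 10–34 (lit key `paper:url-5493eb38cbb7`; the square brackets inside the quotation are the
manuscript's own): "Suppose that `U = X \ S`, where `S ⊆ X(k)` is a finite subset. Then restricting
cohomology classes of `Π_U` to the various `I_x` [cf. Proposition 1.4, (i)], for `x ∈ S`, yields a
natural exact sequence `1 → (k^×)^∧ → H¹(Π_U, M_X) → (⊕_{x ∈ S} Ẑ)` — where we identify
`Hom_Ẑ(I_x, M_X)` with `Ẑ` via the isomorphism `I_x ⥲ M_X` of Proposition 1.4, (ii); `(k^×)^∧`
denotes the profinite completion of `k^×`. Moreover, the image [via `κ_U`] of `Γ(U, 𝒪_U^×)` in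
`H¹(Π_U, M_X)/(k^×)^∧` is equal to the inverse image in `H¹(Π_U, M_X)/(k^×)^∧` of the submodule of
`(⊕_{x ∈ S} ℤ) ⊆ (⊕_{x ∈ S} Ẑ)` determined by the principal divisors [with support in `S`].";
Thm. 1.9 (c) p. 37.  (Doc v2, 2026-08-27, referee finding K25-n9: the earlier header rendered the
second occurrence of the quotient `H¹(Π_U, M_X)/(k^×)^∧` in the «Moreover» sentence as plain
`H¹(Π_U, M_X)` and dropped the closing bracket «[with support in `S`]», both unmarked, inside the
quotation marks; the passage is now quoted verbatim and in full.  No declaration, statement or proof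
was changed; the «Moreover» sentence is quoted for context only and is not typed in this file.)

abc-iut row «ZHAT-DEGREE-MAP» (sequel of `Thm19CuspidalDegreeZHat.lean`, p431111, where the `Ẑ`-valued
cuspidal degree of a class at a cusp was shown to exist uniquely, `CuspSyncPresentation.existsUnique_zhatDegree`).
This file PACKAGES that map and proves it is a group homomorphism (typing policy θ: relative to a model
`M : CurveModel` and a system of cyclotome presentations `P : CuspSyncPresentation h` of `U ⊆ Z`):

* `CuspSyncPresentation.IsZHatDegree P η z c` — the `Ẑ`-degree predicate (the restriction of `η` to `I_z`
  is the class of `i ↦ c • sync_z(i)`); `CuspSyncPresentation.zhatDegree P η z : Ẑ` — THE degree (the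
  unique such `c`); `CuspSyncPresentation.degreeMap P : H¹(Π_U, M_Z) →+ ((Z ∖ U) → Ẑ)` — the printed map
  "`H¹(Π_U, M_X) → ⊕_{x ∈ S} Ẑ`" (finitely many cusps, so `⊕ = ∏`);
* `IsZHatDegree.add/neg/zero`, `zhatDegree_add/neg/zero` — additivity (from the additivity of the class of
  a crossed homomorphism, abc-iut-w5-d213's `crossedHomClass_add/neg`, and uniqueness);
* `isZHatDegree_zero_iff`, **`zhatDegree_eq_zero_iff`** — degree `0` at `z` iff the restriction of `η` to
  `I_z` vanishes; hence **`mem_ker_degreeMap_iff`**: `η ∈ Ker(D)` iff `classRes (I_c) η = 0` for every cusp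
  `c` — the literal left-hand side of abc-iut-L4-t1's named fact `IntrinsicKummerModel.Prop_1_6_iii_ker`,
  which therefore READS "`Ker(D) = galoisClasses`" (`prop_1_6_iii_ker_iff_ker_degreeMap`; the fact itself —
  exactness, i.e. Kummer theory over the Kummer-faithful base field — stays a named hypothesis);
* `hasCuspidalDegree_iff_zhatDegree_eq` — abc-iut-w5-d213's INTEGRAL degree `HasCuspidalDegree P η z n`
  holds iff `zhatDegree P η z = n` ("the submodule of `⊕ ℤ ⊆ ⊕ Ẑ`").

Definitions here are packaging of proved `∃!` statements (no Prop fact, no instance).  HONEST FRAMING: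
model-level bookkeeping of a refereed result; typed/constructed ≠ the exactness claim; nothing here bears
on [IUTchIII] Cor. 3.12.
-/

noncomputable section

open CategoryTheory
open scoped Classical Pointwise

namespace Literature.AnabelianGeometry.AbsoluteAnabelian.AbsTopIII

universe u

namespace CurveModel

variable {M : CurveModel.{u}} {U Z : M.Curve} {h : M.IsCofiniteOpen U Z} (P : M.CuspSyncPresentation h)

namespace CuspSyncPresentation

/-! ### The `Ẑ`-degree predicate, THE degree, the degree map -/

/-- **`c ∈ Ẑ` is a `Ẑ`-valued cuspidal degree of `η` at `z`**: the restriction of `η ∈ H¹(Π_U, M_Z)` to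
`I_z` is the class of the continuous homomorphism `i ↦ c • sync_z(i)` (THE synchronization of Thm. 1.9
(b); `I_z` acts trivially on `M_Z`).  By `existsUnique_zhatDegree` there is exactly one such `c`.
[cite: MochizukiAbsTopIII2015, Prop 1.6 (iii) p.35] -/
def IsZHatDegree (η : cyclotomeModH1 (M.res h) ZHatCoeff.{u}) (z : (M.cusps U).Cusp) (c : ZHatCoeff.{u}) :
    Prop :=
  ∃ (hc : Continuous fun i : (M.cusps U).Icusp z =>
        CyclotomeMod.ofDual (c • (P.syncAt z (Additive.ofMul i)).toDual))
    (hf : ∀ x y : (M.cusps U).Icusp z,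
      (⟨_, hc⟩ : C((M.cusps U).Icusp z, M.inertiaRep h z)) (x * y) =
        (⟨_, hc⟩ : C((M.cusps U).Icusp z, M.inertiaRep h z)) x +
          (M.inertiaRep h z).ρ x ((⟨_, hc⟩ : C((M.cusps U).Icusp z, M.inertiaRep h z)) y)),
    cyclotomeModH1Res (M.res h) ZHatCoeff.{u} ((M.cusps U).Icusp z) η =
      ContinuousCohomology.crossedHomClass (M.inertiaRep h z) ⟨_, hc⟩ hf

/-- There is exactly one `Ẑ`-degree (restatement of `existsUnique_zhatDegree` through the predicate).
[cite: MochizukiAbsTopIII2015, Prop 1.6 (iii) p.35] -/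
theorem existsUnique_isZHatDegree (η : cyclotomeModH1 (M.res h) ZHatCoeff.{u}) (z : (M.cusps U).Cusp) :
    ∃! c : ZHatCoeff.{u}, P.IsZHatDegree η z c :=
  P.existsUnique_zhatDegree η z

/-- **THE `Ẑ`-valued cuspidal degree of `η` at `z`** (the `z`-component of "`H¹(Π_U, M_X) → ⊕_{x ∈ S} Ẑ`",
read through THE synchronization of Thm. 1.9 (b)). [cite: MochizukiAbsTopIII2015, Prop 1.6 (iii) p.35] -/
def zhatDegree (η : cyclotomeModH1 (M.res h) ZHatCoeff.{u}) (z : (M.cusps U).Cusp) : ZHatCoeff.{u} :=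
  Classical.choose (P.existsUnique_isZHatDegree η z).exists

/-- THE degree is a degree. [cite: MochizukiAbsTopIII2015, Prop 1.6 (iii) p.35] -/
theorem isZHatDegree_zhatDegree (η : cyclotomeModH1 (M.res h) ZHatCoeff.{u}) (z : (M.cusps U).Cusp) :
    P.IsZHatDegree η z (P.zhatDegree η z) :=
  Classical.choose_spec (P.existsUnique_isZHatDegree η z).exists

/-- Any degree is THE degree. [cite: MochizukiAbsTopIII2015, Prop 1.6 (iii) p.35] -/
theorem IsZHatDegree.eq_zhatDegree {η : cyclotomeModH1 (M.res h) ZHatCoeff.{u}} {z : (M.cusps U).Cusp}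
    {c : ZHatCoeff.{u}} (hc : P.IsZHatDegree η z c) : c = P.zhatDegree η z :=
  (P.existsUnique_isZHatDegree η z).unique hc (P.isZHatDegree_zhatDegree η z)

/-- `IsZHatDegree P η z c ↔ zhatDegree P η z = c`. [cite: MochizukiAbsTopIII2015, Prop 1.6 (iii) p.35] -/
theorem isZHatDegree_iff_zhatDegree_eq {η : cyclotomeModH1 (M.res h) ZHatCoeff.{u}} {z : (M.cusps U).Cusp}
    {c : ZHatCoeff.{u}} : P.IsZHatDegree η z c ↔ P.zhatDegree η z = c :=
  ⟨fun hc => (hc.eq_zhatDegree P).symm, fun hc => hc ▸ P.isZHatDegree_zhatDegree η z⟩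

/-! ### Additivity -/

/-- The function `i ↦ c • sync_z(i)` with values in `M_Z` (bookkeeping abbreviation-free helper):
pointwise `add`. [cite: MochizukiAbsTopIII2015, Prop 1.6 (iii) p.35] -/
theorem smulSync_add (z : (M.cusps U).Cusp) (c c' : ZHatCoeff.{u}) (i : (M.cusps U).Icusp z) :
    CyclotomeMod.ofDual ((c + c') • (P.syncAt z (Additive.ofMul i)).toDual) =
      CyclotomeMod.ofDual (c • (P.syncAt z (Additive.ofMul i)).toDual) +
        CyclotomeMod.ofDual (c' • (P.syncAt z (Additive.ofMul i)).toDual) := by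
  rw [add_smul]
  rfl

/-- Pointwise `neg`. [cite: MochizukiAbsTopIII2015, Prop 1.6 (iii) p.35] -/
theorem smulSync_neg (z : (M.cusps U).Cusp) (c : ZHatCoeff.{u}) (i : (M.cusps U).Icusp z) :
    CyclotomeMod.ofDual ((-c) • (P.syncAt z (Additive.ofMul i)).toDual) =
      -CyclotomeMod.ofDual (c • (P.syncAt z (Additive.ofMul i)).toDual) := by
  rw [neg_smul]
  rfl

/-- Pointwise `zero`. [cite: MochizukiAbsTopIII2015, Prop 1.6 (iii) p.35] -/
theorem smulSync_zero (z : (M.cusps U).Cusp) (i : (M.cusps U).Icusp z) :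
    CyclotomeMod.ofDual ((0 : ZHatCoeff.{u}) • (P.syncAt z (Additive.ofMul i)).toDual) = 0 := by
  rw [zero_smul]
  rfl

/-- **`Ẑ`-degrees add**: degrees `c` of `η` and `c'` of `η'` at `z` give the degree `c + c'` of `η + η'`.
[cite: MochizukiAbsTopIII2015, Prop 1.6 (iii) p.35] -/
theorem IsZHatDegree.add {η η' : cyclotomeModH1 (M.res h) ZHatCoeff.{u}} {z : (M.cusps U).Cusp}
    {c c' : ZHatCoeff.{u}} (hη : P.IsZHatDegree η z c) (hη' : P.IsZHatDegree η' z c') :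
    P.IsZHatDegree (η + η') z (c + c') := by
  obtain ⟨hc, hf, heq⟩ := hη
  obtain ⟨hc', hf', heq'⟩ := hη'
  have hsum : (⟨_, hc⟩ : C((M.cusps U).Icusp z, M.inertiaRep h z)) + ⟨_, hc'⟩ =
      ⟨fun i : (M.cusps U).Icusp z =>
          CyclotomeMod.ofDual ((c + c') • (P.syncAt z (Additive.ofMul i)).toDual),
        by simpa only [smulSync_add, Pi.add_def] using hc.add hc'⟩ := by
    ext i
    exact (P.smulSync_add z c c' i).symm
  refine ⟨by simpa only [smulSync_add, Pi.add_def] using hc.add hc', ?_, ?_⟩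
  · intro x y
    have h2 := crossedHom_add (M.inertiaRep h z) hf hf' x y
    rw [hsum] at h2
    exact h2
  · have hadd : (cyclotomeModH1Res (M.res h) ZHatCoeff.{u} ((M.cusps U).Icusp z)) (η + η') =
        (cyclotomeModH1Res (M.res h) ZHatCoeff.{u} ((M.cusps U).Icusp z)) η +
          (cyclotomeModH1Res (M.res h) ZHatCoeff.{u} ((M.cusps U).Icusp z)) η' :=
      map_add (cyclotomeModH1Res (M.res h) ZHatCoeff.{u} ((M.cusps U).Icusp z)).hom η η'
    rw [hadd, heq, heq', ← crossedHomClass_add (M.inertiaRep h z) _ _ hf hf'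
      (crossedHom_add (M.inertiaRep h z) hf hf')]
    exact crossedHomClass_congr _ hsum _ _

/-- **`Ẑ`-degrees negate.** [cite: MochizukiAbsTopIII2015, Prop 1.6 (iii) p.35] -/
theorem IsZHatDegree.neg {η : cyclotomeModH1 (M.res h) ZHatCoeff.{u}} {z : (M.cusps U).Cusp}
    {c : ZHatCoeff.{u}} (hη : P.IsZHatDegree η z c) : P.IsZHatDegree (-η) z (-c) := by
  obtain ⟨hc, hf, heq⟩ := hη
  have hneg : -(⟨_, hc⟩ : C((M.cusps U).Icusp z, M.inertiaRep h z)) =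
      ⟨fun i : (M.cusps U).Icusp z =>
          CyclotomeMod.ofDual ((-c) • (P.syncAt z (Additive.ofMul i)).toDual),
        by simpa only [smulSync_neg, Pi.neg_def] using hc.neg⟩ := by
    ext i
    exact (P.smulSync_neg z c i).symm
  refine ⟨by simpa only [smulSync_neg, Pi.neg_def] using hc.neg, ?_, ?_⟩
  · intro x y
    have h2 := crossedHom_neg (M.inertiaRep h z) hf x y
    rw [hneg] at h2
    exact h2
  · have hn : (cyclotomeModH1Res (M.res h) ZHatCoeff.{u} ((M.cusps U).Icusp z)) (-η) =
        -(cyclotomeModH1Res (M.res h) ZHatCoeff.{u} ((M.cusps U).Icusp z)) η :=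
      map_neg (cyclotomeModH1Res (M.res h) ZHatCoeff.{u} ((M.cusps U).Icusp z)).hom η
    rw [hn, heq, ← crossedHomClass_neg (M.inertiaRep h z) _ hf (crossedHom_neg (M.inertiaRep h z) hf)]
    exact crossedHomClass_congr _ hneg _ _

/-- **Degree `0` at `z` iff the restriction to `I_z` vanishes.** [cite: MochizukiAbsTopIII2015, Prop 1.6 (iii) p.35] -/
theorem isZHatDegree_zero_iff (η : cyclotomeModH1 (M.res h) ZHatCoeff.{u}) (z : (M.cusps U).Cusp) :
    P.IsZHatDegree η z 0 ↔
      cyclotomeModH1Res (M.res h) ZHatCoeff.{u} ((M.cusps U).Icusp z) η = 0 := by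
  have hc : Continuous fun i : (M.cusps U).Icusp z =>
      CyclotomeMod.ofDual ((0 : ZHatCoeff.{u}) • (P.syncAt z (Additive.ofMul i)).toDual) := by
    simp only [smulSync_zero]
    exact continuous_const
  have h0 : ∀ g, (⟨_, hc⟩ : C((M.cusps U).Icusp z, M.inertiaRep h z)) g = 0 := fun g =>
    P.smulSync_zero z g
  have hf : ∀ x y : (M.cusps U).Icusp z,
      (⟨_, hc⟩ : C((M.cusps U).Icusp z, M.inertiaRep h z)) (x * y) =
        (⟨_, hc⟩ : C((M.cusps U).Icusp z, M.inertiaRep h z)) x +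
          (M.inertiaRep h z).ρ x ((⟨_, hc⟩ : C((M.cusps U).Icusp z, M.inertiaRep h z)) y) := by
    intro x y
    rw [h0, h0, h0, map_zero, add_zero]
  constructor
  · rintro ⟨hc', hf', heq⟩
    rw [heq]
    exact crossedHomClass_zero _ _ (fun g => P.smulSync_zero z g) hf'
  · intro hres
    refine ⟨hc, hf, ?_⟩
    rw [hres, crossedHomClass_zero _ _ h0 hf]

/-- The zero class has `Ẑ`-degree `0`. [cite: MochizukiAbsTopIII2015, Prop 1.6 (iii) p.35] -/
theorem isZHatDegree_zero (z : (M.cusps U).Cusp) :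
    P.IsZHatDegree (0 : cyclotomeModH1 (M.res h) ZHatCoeff.{u}) z 0 :=
  (P.isZHatDegree_zero_iff 0 z).2 (map_zero (cyclotomeModH1Res (M.res h) ZHatCoeff.{u} ((M.cusps U).Icusp z)).hom)

/-- `D_z(0) = 0`. [cite: MochizukiAbsTopIII2015, Prop 1.6 (iii) p.35] -/
theorem zhatDegree_zero (z : (M.cusps U).Cusp) :
    P.zhatDegree (0 : cyclotomeModH1 (M.res h) ZHatCoeff.{u}) z = 0 :=
  ((P.isZHatDegree_zero z).eq_zhatDegree P).symm

/-- `D_z(η + η') = D_z(η) + D_z(η')`. [cite: MochizukiAbsTopIII2015, Prop 1.6 (iii) p.35] -/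
theorem zhatDegree_add (η η' : cyclotomeModH1 (M.res h) ZHatCoeff.{u}) (z : (M.cusps U).Cusp) :
    P.zhatDegree (η + η') z = P.zhatDegree η z + P.zhatDegree η' z :=
  (((P.isZHatDegree_zhatDegree η z).add P (P.isZHatDegree_zhatDegree η' z)).eq_zhatDegree P).symm

/-- `D_z(-η) = -D_z(η)`. [cite: MochizukiAbsTopIII2015, Prop 1.6 (iii) p.35] -/
theorem zhatDegree_neg (η : cyclotomeModH1 (M.res h) ZHatCoeff.{u}) (z : (M.cusps U).Cusp) :
    P.zhatDegree (-η) z = -P.zhatDegree η z :=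
  (((P.isZHatDegree_zhatDegree η z).neg P).eq_zhatDegree P).symm

/-- **`D_z(η) = 0` iff `η|_{I_z} = 0`.** [cite: MochizukiAbsTopIII2015, Prop 1.6 (iii) p.35] -/
theorem zhatDegree_eq_zero_iff (η : cyclotomeModH1 (M.res h) ZHatCoeff.{u}) (z : (M.cusps U).Cusp) :
    P.zhatDegree η z = 0 ↔ cyclotomeModH1Res (M.res h) ZHatCoeff.{u} ((M.cusps U).Icusp z) η = 0 := by
  rw [← P.isZHatDegree_zero_iff η z, isZHatDegree_iff_zhatDegree_eq]

/-- **The cuspidal degree map `D : H¹(Π_U, M_Z) → ⊕_{z ∈ Z ∖ U} Ẑ`** of Prop. 1.6 (iii) ("restricting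
cohomology classes of `Π_U` to the various `I_x` [...] where we identify `Hom_Ẑ(I_x, M_X)` with `Ẑ` via the
isomorphism `I_x ⥲ M_X`"), as a homomorphism of abelian groups (finitely many cusps: `⊕ = ∏`).
[cite: MochizukiAbsTopIII2015, Prop 1.6 (iii) p.35] -/
def degreeMap : cyclotomeModH1 (M.res h) ZHatCoeff.{u} →+ ((M.cusps U).Cusp → ZHatCoeff.{u}) where
  toFun η := fun z => P.zhatDegree η z
  map_zero' := funext fun z => P.zhatDegree_zero z
  map_add' η η' := funext fun z => P.zhatDegree_add η η' z

/-- Components of the degree map. [cite: MochizukiAbsTopIII2015, Prop 1.6 (iii) p.35] -/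
@[simp] theorem degreeMap_apply (η : cyclotomeModH1 (M.res h) ZHatCoeff.{u}) (z : (M.cusps U).Cusp) :
    P.degreeMap η z = P.zhatDegree η z :=
  rfl

/-- **Kernel of the degree map**: `D(η) = 0` iff the restriction of `η` to EVERY cuspidal inertia group
vanishes. [cite: MochizukiAbsTopIII2015, Prop 1.6 (iii) p.35] -/
theorem mem_ker_degreeMap_iff (η : cyclotomeModH1 (M.res h) ZHatCoeff.{u}) :
    η ∈ (P.degreeMap).ker ↔
      ∀ c : (M.cusps U).Cusp, cyclotomeModH1Res (M.res h) ZHatCoeff.{u} ((M.cusps U).Icusp c) η = 0 := by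
  rw [AddMonoidHom.mem_ker]
  constructor
  · intro h0 c
    rw [← P.zhatDegree_eq_zero_iff η c, ← P.degreeMap_apply η c, h0]
    rfl
  · intro hall
    funext c
    rw [P.degreeMap_apply, (P.zhatDegree_eq_zero_iff η c).2 (hall c)]
    rfl

/-- **Integral degree = `Ẑ`-degree in `ℤ`** ("the submodule of `⊕ ℤ ⊆ ⊕ Ẑ`"): abc-iut-w5-d213's
`HasCuspidalDegree P η z n` holds iff `D_z(η) = n`. [cite: MochizukiAbsTopIII2015, Prop 1.6 (iii) p.35] -/
theorem hasCuspidalDegree_iff_zhatDegree_eq (η : cyclotomeModH1 (M.res h) ZHatCoeff.{u})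
    (z : (M.cusps U).Cusp) (n : ℤ) : HasCuspidalDegree P η z n ↔ P.zhatDegree η z = (n : ZHatCoeff.{u}) := by
  rw [P.hasCuspidalDegree_iff_zhatDegree_intCast η z n, ← isZHatDegree_iff_zhatDegree_eq]
  rfl

/-- A class lies in abc-iut-w5-d213's group-theoretic `P_U^{gt}`-style locus "all cuspidal degrees
integral" iff its degree vector lies in `⊕ ℤ ⊆ ⊕ Ẑ`. [cite: MochizukiAbsTopIII2015, Prop 1.6 (iii) p.35] -/
theorem exists_hasCuspidalDegree_iff (η : cyclotomeModH1 (M.res h) ZHatCoeff.{u}) (z : (M.cusps U).Cusp) :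
    (∃ n : ℤ, HasCuspidalDegree P η z n) ↔ P.zhatDegree η z ∈ Set.range (Int.cast : ℤ → ZHatCoeff.{u}) := by
  constructor
  · rintro ⟨n, hn⟩
    exact ⟨n, ((P.hasCuspidalDegree_iff_zhatDegree_eq η z n).1 hn).symm⟩
  · rintro ⟨n, hn⟩
    exact ⟨n, (P.hasCuspidalDegree_iff_zhatDegree_eq η z n).2 hn.symm⟩

end CuspSyncPresentation

end CurveModel

/-! ### The kernel of `D` and abc-iut-L4-t1's `Prop_1_6_iii_ker` -/

namespace IntrinsicKummerModel

variable (M : IntrinsicKummerModel.{u})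

/-- For an intrinsic Kummer model, `η ∈ Ker(D)` iff `classRes (I_c) η = 0` for every cusp `c` — the literal
left-hand side of the named fact `Prop_1_6_iii_ker`. [cite: MochizukiAbsTopIII2015, Prop 1.6 (iii) p.35] -/
theorem mem_ker_degreeMap_iff_classRes {U X : M.Curve} {h : M.IsCofiniteOpen U X}
    (P : M.toCurveModel.CuspSyncPresentation h) (η : cyclotomeModH1 (M.res h) ZHatCoeff.{u}) :
    η ∈ (P.degreeMap).ker ↔ ∀ c : (M.cusps U).Cusp, M.classRes h ((M.cusps U).Icusp c) η = 0 :=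
  P.mem_ker_degreeMap_iff η

/-- **`Prop_1_6_iii_ker` READS "`Ker(D) = (k^×)^∧`"**: abc-iut-L4-t1's named fact (exactness of
`1 → (k^×)^∧ → H¹(Π_U, M_X) →ᴰ ⊕ Ẑ` at the middle term, with `(k^×)^∧` realised as `galoisClasses`) is
EQUIVALENT to: for every `U ⊆ X` as there and every system of cyclotome presentations `P`, the kernel of
the degree map `D` is `galoisClasses`.  (Presentations exist under Prop. 1.4 (i); the statement is
vacuous-free only where they do — as for `Thm19c`.) [cite: MochizukiAbsTopIII2015, Prop 1.6 (iii) p.35] -/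
theorem ker_degreeMap_eq_galoisClasses_of_prop_1_6_iii_ker (hker : M.Prop_1_6_iii_ker) {U X : M.Curve}
    (h : M.IsCofiniteOpen U X) (hX : M.IsProper X) (hU : M.IsScheme U) (hXs : M.IsScheme X)
    (hg : 2 ≤ M.genus X) (hk : IsKummerFaithful (M.base U))
    (hrat : ∀ c : (M.cusps U).Cusp, (M.cusps U).IsRational c)
    (P : M.toCurveModel.CuspSyncPresentation h) :
    ((P.degreeMap).ker : Set (cyclotomeModH1 (M.res h) ZHatCoeff.{u})) = M.galoisClasses h := by
  ext η
  rw [SetLike.mem_coe, M.mem_ker_degreeMap_iff_classRes P η, hker U X h hX hU hXs hg hk hrat η]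
  rfl

end IntrinsicKummerModel

end Literature.AnabelianGeometry.AbsoluteAnabelian.AbsTopIII

end
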